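import Summits.AtomisticToContinuum.BoseEinsteinCondensation.Theorems.StaticResponseBound.Negative.UvThomsonFlowPotential

/-!
# Negative lemmas for crux `StaticResponseBound` (stmt-AtomisticToContinuum-12057) — IV:
# the free displacement flow is a gradient (part B: `L_F f = |p|V_p + Q_F` and the CONVERSE of S4)

Supports (does not close) stmt-AtomisticToContinuum-12057.  Refuter (drefute, generation 2)
by-products for the picked line `Cruxes/StaticResponseBound/Lines/uv-thomson-force-wave.lean`
(active skeleton 3398ea4f…).  Sorry-free; axioms standard.  Part A (`UvThomsonFlowPotential.lean`)
has the flow potential `f = −V_p/|p|` (`∇f = Y`, `Δf = |p|V_p`); stub S4 itself (the direction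
`‖Q − Q̄‖₋₁ ≤ √B ⇒ |p|‖V_p − V̄‖₋₁ ≤ √N + √B`) is the lead's landed
`Theorems/BECInsertionCorrectorStaticResponseBoundThomsonReduction.lean`.  This file adds:

* `langevinGen_flowPot` — the STRONG form `L_F f = |p| V_p + Q_F` pointwise, for a differentiable
  nonvanishing weight (`Q_F = forceWaveW`, verbatim the line's `forceWave` for `F = |Φ|`);
  `integral_forceWaveW_mul_sq` (centring `∫Q_F F² = −|p|∫V_p F²`);
  `hMinusOneSqW_langevinGen_flowPot` (`‖L_F f‖²₋₁ = 𝓔_F(f,f)`, via the tree's Green identity) and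
  `_le` (`≤ N∫F²`).
* `forceWave_le_of_susceptibility` / `_pos` — **the converse of S4** for positive `C¹` weights (S5's
  real, everywhere-positive ground states): `‖V_p − V̄‖²₋₁ ≤ B ⇒ ‖Q_F − Q̄‖²₋₁ ≤ (√N + |p|√B)²`.
  Consequently S5 `UvForceWaveBound` is EQUIVALENT (constants `(1 + √·)²` each way) to the
  susceptibility bound `|p|² ‖V_p − V̄‖²_{H₋₁(Φ_s²)} ≤ K′N` for the same weakly modulated ground states
  `Φ_s` of the truncated potentials: the force-wave dress is a bijection of statements — S5 carries
  exactly the `t → 0` (curvature at every weak coupling) content of the crux's UV half; information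
  for the lead and the planner, not a defect.
-/

namespace Summit.AtomisticToContinuum.BoseEinsteinCondensation.Theorems.StaticResponseBound.Negative.UvThomsonFlow

open MeasureTheory
open scoped ENNReal
open Literature.MathematicalPhysics.QuantumManyBody.BoseGas
open Summit.AtomisticToContinuum.BoseEinsteinCondensation.Theorems.StaticResponseBound.Negative

noncomputable section

variable {N : ℕ}

/-! ## §4  The force wave is `L_F f − |p| V_p` -/

/-- The force-density wave of a general real weight `F` (`F² dX` the symmetrising measure):
`Q_F = (∑ⱼ sin θ(xⱼ) p̂·∇ⱼ F²)/F²`; for `F = |Φ|` this is verbatim the line's `forceWave`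
(`forceWave_eq_forceWaveW`). [card uv-thomson-force-wave] -/
def forceWaveW (L : ℝ) (k : Fin 3 → ℤ) (F : Config N → ℝ) (X : Config N) : ℝ :=
  (∑ j : Fin N, Real.sin (arg L k (X j)) *
      ∑ m : Fin 3, UvThomsonStubs.khat k m * pderiv j m (fun Y => F Y ^ 2) X) / F X ^ 2

/-- The line's `forceWave L k Φ` is `forceWaveW` of the weight `|Φ|`. -/
theorem forceWave_eq_forceWaveW (L : ℝ) (k : Fin 3 → ℤ) (Φ : PeriodicTrialState N L) (X : Config N) :
    UvThomsonStubs.forceWave L k Φ X = forceWaveW L k (fun Y => ‖Φ.ψ Y‖) X := rfl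

/-- **`L_F f = |p| V_p + Q_F`** at every point where the weight is differentiable and nonzero:
the Langevin generator of the weight applied to the flow potential is `|p|` times the density wave
plus the force wave (`Δf = |p|V_p`, `2∇log F·∇f = ∇log F²·Y = Q_F`). This is the identity that makes
S4 `ThomsonReduction` and its converse one triangle inequality each. [card uv-thomson-force-wave] -/
theorem langevinGen_flowPot {L : ℝ} (hL : 0 < L) (k : Fin 3 → ℤ) {F : Config N → ℝ}
    {X : Config N} (hF : DifferentiableAt ℝ F X) (h0 : F X ≠ 0) :
    langevinGen F (flowPot L k) X = Real.sqrt (psq L k) * densityWave L k X + forceWaveW L k F X := by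
  rw [langevinGen_eq_div hF h0, configLaplacian_flowPot]
  congr 1
  unfold forceWaveW gradDot
  simp_rw [pderiv_flowPot_eq_khat hL, pderiv_fun_sq hF]
  rw [eq_div_iff (pow_ne_zero 2 h0), div_mul_eq_mul_div, div_mul_eq_mul_div]
  rw [div_eq_iff h0]
  rw [Finset.mul_sum, Finset.sum_mul, Finset.sum_mul]
  refine Finset.sum_congr rfl fun j _ => ?_
  rw [Finset.mul_sum, Finset.mul_sum, Finset.sum_mul, Finset.sum_mul]
  refine Finset.sum_congr rfl fun m _ => ?_
  ring

/-- The force wave of a `C¹` nonvanishing weight is continuous. [folklore] -/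
theorem continuous_forceWaveW {L : ℝ} (hL : 0 < L) (k : Fin 3 → ℤ) {F : Config N → ℝ}
    (hF : ContDiff ℝ 1 F) (h0 : ∀ X, F X ≠ 0) : Continuous (forceWaveW L k F) := by
  have h : forceWaveW L k F = fun X =>
      langevinGen F (flowPot L k) X - Real.sqrt (psq L k) * densityWave L k X := by
    funext X
    rw [langevinGen_flowPot hL k ((hF.differentiable (by simp)) X) (h0 X)]
    ring
  rw [h]
  exact (continuous_langevinGen hF h0 (contDiff_flowPot L k)).sub
    (continuous_const.mul (continuous_densityWave L k))

/-- **Centring**: `∫ Q_F F² = -|p| ∫ V_p F²` (`∫ (L_F f) F² = 0` by invariance of `F² dX`). [folklore] -/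
theorem integral_forceWaveW_mul_sq {L : ℝ} (hL : 0 < L) (k : Fin 3 → ℤ) {F : Config N → ℝ}
    (hF : ContDiff ℝ 1 F) (hFper : IsLatticePeriodic L F) (h0 : ∀ X, F X ≠ 0) :
    ∫ X in cellN N L, forceWaveW L k F X * F X ^ 2 =
      -(Real.sqrt (psq L k) * ∫ X in cellN N L, densityWave L k X * F X ^ 2) := by
  have hpt : ∀ X, forceWaveW L k F X * F X ^ 2 =
      langevinGen F (flowPot L k) X * F X ^ 2 -
        Real.sqrt (psq L k) * (densityWave L k X * F X ^ 2) := by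
    intro X
    rw [langevinGen_flowPot hL k ((hF.differentiable (by simp)) X) (h0 X)]
    ring
  simp_rw [hpt]
  have hi₁ : Integrable (fun X => langevinGen F (flowPot L k) X * F X ^ 2)
      (volume.restrict (cellN N L)) :=
    integrableOn_cellN ((continuous_langevinGen hF h0 (contDiff_flowPot L k)).mul
      (hF.continuous.pow 2)) L
  have hi₂ : Integrable (fun X => Real.sqrt (psq L k) * (densityWave L k X * F X ^ 2))
      (volume.restrict (cellN N L)) :=
    (integrableOn_cellN ((continuous_densityWave L k).mul (hF.continuous.pow 2)) L).const_mul _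
  rw [integral_sub hi₁ hi₂, integral_langevinGen_mul_sq hL hF hFper h0 (contDiff_flowPot L k)
    (isLatticePeriodic_flowPot hL.ne' k), integral_const_mul, zero_sub]

/-- **`‖L_F f‖²₋₁ = 𝓔_F(f, f)`**: the `H₋₁` norm of the generator applied to the flow potential is
the flow's energy (`-f` is a strong corrector of `L_F f`; Kipnis–Landim `‖Sf‖₋₁ = ‖f‖₁`).
[cite: KipnisLandim1999, App. 1 §6] -/
theorem hMinusOneSqW_langevinGen_flowPot {L : ℝ} (hL : 0 < L) (k : Fin 3 → ℤ) {F : Config N → ℝ}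
    (hF : ContDiff ℝ 1 F) (hFper : IsLatticePeriodic L F) (h0 : ∀ X, F X ≠ 0) :
    hMinusOneSqW L F (langevinGen F (flowPot L k)) =
      ENNReal.ofReal (dirichletFormW L F (flowPot L k) (flowPot L k)) := by
  have hfun : (fun Y => -flowPot (N := N) L k Y) = (-1 : ℝ) • flowPot L k := by
    funext Y; simp
  have hneg : ∀ X, -langevinGen F (fun Y => -flowPot L k Y) X = langevinGen F (flowPot L k) X := by
    intro X
    rw [hfun, langevinGen, configLaplacian_smul, gradDot_smul_right, langevinGen]
    ring
  have hW := IsWeakCorrector.of_langevinGen hL hF hFper h0 ((contDiff_flowPot L k).neg)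
    ((isLatticePeriodic_flowPot hL.ne' k).neg) hneg
  rw [hW.hMinusOneSqW_eq hF.continuous, ← hW.dirichletFormW_self]
  congr 1
  rw [hfun, dirichletFormW_smul_left, dirichletFormW_smul_right]
  ring

/-- **The free flow has energy at most `N`**: `‖L_F f‖²₋₁ ≤ N ∫ F²` — with `∫ F² = 1`, the `√N`
of S4 `ThomsonReduction`. [card uv-thomson-force-wave] -/
theorem hMinusOneSqW_langevinGen_flowPot_le {L : ℝ} (hL : 0 < L) {k : Fin 3 → ℤ} (hk : k ≠ 0)
    {F : Config N → ℝ} (hF : ContDiff ℝ 1 F) (hFper : IsLatticePeriodic L F) (h0 : ∀ X, F X ≠ 0) :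
    hMinusOneSqW L F (langevinGen F (flowPot L k)) ≤
      ENNReal.ofReal (N * ∫ X in cellN N L, F X ^ 2) := by
  rw [hMinusOneSqW_langevinGen_flowPot hL k hF hFper h0]
  refine ENNReal.ofReal_le_ofReal ?_
  rw [dirichletFormW, ← integral_const_mul]
  refine integral_mono_of_nonneg (ae_of_all _ fun X => ?_) ?_ (ae_of_all _ fun X => ?_)
  · exact mul_nonneg (gradDot_self_nonneg _ _) (sq_nonneg _)
  · exact (integrableOn_cellN (hF.continuous.pow 2) L).const_mul _
  · exact mul_le_mul_of_nonneg_right (gradDot_flowPot_self_le hL hk X) (sq_nonneg _)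

/-! ## §5  The converse of S4 `ThomsonReduction` for positive weights -/

/-- **Converse of S4** (positive `C¹` weight, `∫F² = 1`): a susceptibility bound
`‖V_p − V̄‖²₋₁ ≤ B` gives the force-wave bound `‖Q_F − Q̄‖²₋₁ ≤ (√N + |p|√B)²`, because
`Q_F − Q̄ = L_F f − |p|(V_p − V̄)` pointwise. Hence S5 `UvForceWaveBound` is EQUIVALENT (constants
`(1 + √·)²` both ways) to the `t → 0` susceptibility bound `|p|²‖V_p − V̄‖²₋₁ ≤ K′N` for the same
family of modulated ground states: the force-wave dress neither weakens nor strengthens it.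
[card uv-thomson-force-wave] -/
theorem forceWave_le_of_susceptibility {L : ℝ} (hL : 0 < L) {k : Fin 3 → ℤ} (hk : k ≠ 0)
    {F : Config N → ℝ} (hF : ContDiff ℝ 1 F) (hFper : IsLatticePeriodic L F) (h0 : ∀ X, F X ≠ 0)
    (hZ : ∫ X in cellN N L, F X ^ 2 = 1) {B : ℝ} (hB : 0 ≤ B)
    (hV : hMinusOneSqW L F
        (fun X => densityWave L k X - ∫ Y in cellN N L, densityWave L k Y * F Y ^ 2) ≤
      ENNReal.ofReal B) :
    hMinusOneSqW L F
        (fun X => forceWaveW L k F X - ∫ Y in cellN N L, forceWaveW L k F Y * F Y ^ 2) ≤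
      ENNReal.ofReal ((Real.sqrt N + Real.sqrt (psq L k * B)) ^ 2) := by
  set c : ℝ := Real.sqrt (psq L k) with hc
  have hp : 0 < psq L k := psq_pos hL.ne' hk
  have hc2 : c ^ 2 = psq L k := Real.sq_sqrt hp.le
  set Vbar : ℝ := ∫ Y in cellN N L, densityWave L k Y * F Y ^ 2 with hVbar
  set Qbar : ℝ := ∫ Y in cellN N L, forceWaveW L k F Y * F Y ^ 2 with hQbar
  have hQbar' : Qbar = -(c * Vbar) := integral_forceWaveW_mul_sq hL k hF hFper h0
  set g₁ : Config N → ℝ := langevinGen F (flowPot L k) with hg₁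
  set g₂ : Config N → ℝ := fun X => (-c) * (densityWave L k X - Vbar) with hg₂
  have hg₁c : Continuous g₁ := continuous_langevinGen hF h0 (contDiff_flowPot L k)
  have hg₂c : Continuous g₂ := continuous_const.mul ((continuous_densityWave L k).sub continuous_const)
  have h₁ : hMinusOneSqW L F g₁ ≤ ENNReal.ofReal N := by
    have := hMinusOneSqW_langevinGen_flowPot_le hL hk hF hFper h0
    rwa [hZ, mul_one] at this
  have h₂ : hMinusOneSqW L F g₂ ≤ ENNReal.ofReal (psq L k * B) := by
    rw [hg₂, show (fun X => (-c) * (densityWave L k X - Vbar)) =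
      (-c) • (fun X => densityWave L k X - Vbar) from rfl, hMinusOneSqW_smul, neg_sq, hc2,
      ENNReal.ofReal_mul hp.le]
    gcongr
  have htri := hMinusOneSqW_add_le hF.continuous hg₁c hg₂c (Nat.cast_nonneg N) (by positivity) h₁ h₂
  have hpt : (fun X => forceWaveW L k F X - Qbar) = g₁ + g₂ := by
    funext X
    simp only [Pi.add_apply, hg₁, hg₂]
    rw [langevinGen_flowPot hL k ((hF.differentiable (by simp)) X) (h0 X), hQbar']
    ring
  rw [hpt]
  exact htri

/-! ## §6  Specialisation to the line's setting: real, everywhere-positive trial states -/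

section TrialState

variable {L : ℝ} {k : Fin 3 → ℤ}

/-- For a real nonnegative trial state, `|Φ| = Re Φ` is `C¹`. [folklore] -/
theorem contDiff_norm_of_real (Φ : PeriodicTrialState N L) (hreal : ∀ X, Φ.ψ X = (‖Φ.ψ X‖ : ℂ)) :
    ContDiff ℝ 1 (fun X => ‖Φ.ψ X‖) := by
  have h : (fun X => ‖Φ.ψ X‖) = fun X => (Φ.ψ X).re := by
    funext X
    conv_rhs => rw [hreal X]
    simp
  rw [h]
  exact Complex.reCLM.contDiff.comp Φ.contDiff

/-- `|Φ|` is lattice periodic. [folklore] -/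
theorem isLatticePeriodic_norm (Φ : PeriodicTrialState N L) :
    IsLatticePeriodic L (fun X => ‖Φ.ψ X‖) := fun X i m => by
  simp only [Φ.periodic X i m]

/-- **The converse in the line's setting**: for S5's positive real `Φ`, a susceptibility bound
`‖V_p − ⟨V_p⟩_Φ‖²₋₁ ≤ B` forces `‖Q_Φ − Q̄‖²₋₁ ≤ (√N + |p|√B)²`. So S5 `UvForceWaveBound` holds iff
`|p|² ‖V_p − V̄‖²_{H₋₁(Φ_s²)} ≤ K′N` holds for the same weakly modulated ground states `Φ_s` — S5 is
exactly the `t → 0` (curvature) content of the crux's UV half AT EVERY weak coupling `s`, for the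
truncated potentials. [card uv-thomson-force-wave] -/
theorem forceWave_le_of_susceptibility_pos (N : ℕ) (L : ℝ) (hL : 0 < L) (k : Fin 3 → ℤ)
    (hk : k ≠ 0) (Φ : PeriodicTrialState N L) (hreal : ∀ X, Φ.ψ X = (‖Φ.ψ X‖ : ℂ))
    (hpos : ∀ X, Φ.ψ X ≠ 0) (B : ℝ) (hB : 0 ≤ B)
    (hV : hMinusOneSqW L (fun X => ‖Φ.ψ X‖)
        (fun X => (∑ j, Real.cos (2 * Real.pi / L * ∑ i, (k i : ℝ) * X j i)) - cosMean L k Φ)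
      ≤ ENNReal.ofReal B) :
    hMinusOneSqW L (fun X => ‖Φ.ψ X‖)
        (fun X => UvThomsonStubs.forceWave L k Φ X -
          ∫ Y in cellN N L, UvThomsonStubs.forceWave L k Φ Y * ‖Φ.ψ Y‖ ^ 2)
      ≤ ENNReal.ofReal ((Real.sqrt N + Real.sqrt (psq L k * B)) ^ 2) := by
  have hF := contDiff_norm_of_real Φ hreal
  have h0 : ∀ X, ‖Φ.ψ X‖ ≠ 0 := fun X => norm_ne_zero_iff.mpr (hpos X)
  have hZ : ∫ X in cellN N L, ‖Φ.ψ X‖ ^ 2 = 1 := integral_norm_sq_eq_one Φ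
  exact forceWave_le_of_susceptibility hL hk hF (isLatticePeriodic_norm Φ) h0 hZ hB hV

end TrialState

end

end Summit.AtomisticToContinuum.BoseEinsteinCondensation.Theorems.StaticResponseBound.Negative.UvThomsonFlow
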